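import Literature.AlgebraicGeometry.Motives.HodgeStructureExteriorAlgebraWeylOperator
import Literature.AlgebraicGeometry.Motives.HodgeStructureExteriorAlgebraSelfAdjoint
import Literature.Algebra.Lie.LefschetzModuleWeylOperatorSelfAdjoint
import HarnessLib

/-!
# The Weyl operator and André's `*_H` of `⋀ W` are self-adjoint for the Poincaré pairing `(x, y) ↦ τ_ω(x ∧ y)`;
# for `(x, y) ↦ τ_ω(x ∧ *_H y)` the transposition exchanges `e_ω` and `Λ_ω` (André 1996, §1.1 remark; Prop. 1.2, last clause)

[topic AlgebraicGeometry/Motives]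

Layer `Literature/AlgebraicGeometry/Motives`, lane `lit-hodgefound` (Track 2 foundations library; prover seat `lit-hodgefound-p34`,
generation 31, row g31-#5).  THEOREMS ONLY (no definition, no named fact, no instance, no notation; D-0026 net debt `0`): the abstract
self-adjointness statements of `Algebra/Lie/LefschetzModuleWeylOperatorSelfAdjoint` (row g31-#4) READ on the exterior algebra of a
symplectic space with the trace pairing `τ_ω` of `Motives/HodgeStructureExteriorAlgebraSelfAdjoint` (row g30-#4: `h` is skew-adjoint,
`e_ω` is self-adjoint for `(x, y) ↦ τ_ω(x ∧ y)`), for the operators `weylStar ω g`, `andreStar ω g` of row g31-#3.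

## Source, VERBATIM (Y. André, Publ. Math. IHÉS 83 (1996), held `paper:doi-10-1007-bf02698643`)

§1.1 (p. 11 = p0008 L12–L14): "Remarquons aussi que `L`, `*_L`, `*_H` et `ᶜΛ` sont auto-adjoints relativement à l'accouplement de
dualité de Poincaré `(x, y) ↦ ∫ x ∪ y`."  Prop. 1.2 (p. 11): "Via cet isomorphisme, la transposition relative à la forme bilinéaire
`(x, y) ↦ ∫ x ∪ *y` correspond à la transposition des matrices, pour `* = *_L ou *_H`."

## Contents (all proved; `τ = trace ω g`, `w = weylStar ω g`, `*_H = andreStar ω g`, `Λ_ω = lefschetzDual ω g`)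

* **`IsSymplectic.isSelfAdjoint_andreStar_trace`** / `IsSymplectic.trace_andreStar_mul` (`τ(*_H x ∧ y) = τ(x ∧ *_H y)`),
  **`IsSymplectic.isSelfAdjoint_weylStar_trace`** / `IsSymplectic.trace_weylStar_mul` (`τ(w x ∧ y) = τ(x ∧ w y)`);
* **`IsSymplectic.trace_mul_mul_andreStar`** (`τ(ω ∧ x ∧ *_H y) = τ(x ∧ *_H (Λ_ω y))`: for `(x, y) ↦ τ(x ∧ *_H y)` the transpose of `e_ω` is
  `Λ_ω`, "la transposition des matrices"), `IsSymplectic.trace_lefschetzDual_mul_andreStar` (`τ(Λ_ω x ∧ *_H y) = τ(x ∧ *_H (ω ∧ y))`),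
  `IsSymplectic.trace_mul_mul_weylStar` (`τ(ω ∧ x ∧ w y) = −τ(x ∧ w (Λ_ω y))`);
* graded symmetry: `IsSymplectic.trace_mul_andreStar_swap`, `IsSymplectic.trace_mul_weylStar_swap` (`τ(x ∧ *y) = (−1)ᵃ τ(y ∧ *x)` on `⋀ᵃ W`).

## References

* [Andre1996Motifs] Y. André, *Pour une théorie inconditionnelle des motifs*, Publ. Math. IHÉS 83 (1996) 5–49, §1.1 (p. 11), Prop. 1.2 (p. 11).
* [BourbakiAlgebre1a3] N. Bourbaki, *Algèbre*, Ch. III §7 no. 1 (graded commutativity of the exterior algebra).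
-/

noncomputable section

namespace Literature.AlgebraicGeometry.Motives.ExteriorLefschetz

open Literature.Algebra.Lie ExteriorAlgebra Module Function Set
open Literature.Algebra.Lie.HasLefschetzProperty (primitiveSpace mem_primitiveSpace_iff)

universe u v

variable {K : Type u} [Field K] [CharZero K] {W : Type v} [AddCommGroup W] [Module K W]
variable {ω : ExteriorAlgebra K W} {g : ℕ}

/-! ## §1 `w` and `*_H` are self-adjoint for `τ` -/

/-- **"`*_H` […] auto-adjoint" for ANDRÉ'S `*_H` on `⋀ W`**: `*_H` is self-adjoint for `(x, y) ↦ τ(x ∧ y)`. [cite: Andre1996Motifs, §1.1 (p. 11)] -/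
theorem IsSymplectic.isSelfAdjoint_andreStar_trace (hω : IsSymplectic ω g) :
    ((LinearMap.mul K (ExteriorAlgebra K W)).compr₂ (trace ω g)).IsSelfAdjoint ⇑(andreStar ω g) := by
  haveI := hω.finiteDimensional_exteriorAlgebra
  rw [hω.andreStar_eq]
  exact hω.hasLefschetzProperty_mul.isSelfAdjoint_andreHodgeInvolution _ g (isSkewAdjoint_shiftedDegree_trace ω g)
    (isSelfAdjoint_mul_trace hω.mem ω g)

/-- Displayed form: `τ(*_H x ∧ y) = τ(x ∧ *_H y)`. [cite: Andre1996Motifs, §1.1 (p. 11)] -/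
theorem IsSymplectic.trace_andreStar_mul (hω : IsSymplectic ω g) (x y : ExteriorAlgebra K W) :
    trace ω g (andreStar ω g x * y) = trace ω g (x * andreStar ω g y) := by
  have h1 := hω.isSelfAdjoint_andreStar_trace x y
  simpa only [LinearMap.compr₂_apply, LinearMap.mul_apply'] using h1

/-- **The Weyl operator of `⋀ W` is self-adjoint for `τ`.** [cite: Andre1996Motifs, §1.1 (p. 11) and §1.2 (p. 11)] -/
theorem IsSymplectic.isSelfAdjoint_weylStar_trace (hω : IsSymplectic ω g) :
    ((LinearMap.mul K (ExteriorAlgebra K W)).compr₂ (trace ω g)).IsSelfAdjoint ⇑(weylStar ω g) := by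
  haveI := hω.finiteDimensional_exteriorAlgebra
  rw [hω.weylStar_eq]
  exact hω.hasLefschetzProperty_mul.isSelfAdjoint_weylOperator _ (isSkewAdjoint_shiftedDegree_trace ω g)
    (isSelfAdjoint_mul_trace hω.mem ω g)

/-- Displayed form: `τ(w x ∧ y) = τ(x ∧ w y)`. [cite: Andre1996Motifs, §1.1 (p. 11) and §1.2 (p. 11)] -/
theorem IsSymplectic.trace_weylStar_mul (hω : IsSymplectic ω g) (x y : ExteriorAlgebra K W) :
    trace ω g (weylStar ω g x * y) = trace ω g (x * weylStar ω g y) := by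
  have h1 := hω.isSelfAdjoint_weylStar_trace x y
  simpa only [LinearMap.compr₂_apply, LinearMap.mul_apply'] using h1

/-! ## §2 Prop. 1.2, last clause: for `(x, y) ↦ τ(x ∧ *_H y)` the transpose of `e_ω` is `Λ_ω` -/

/-- **"la transposition relative à `(x, y) ↦ ∫ x ∪ *_H y` correspond à la transposition des matrices": `τ(ω ∧ x ∧ *_H y) = τ(x ∧ *_H (Λ_ω y))`**
(`g ≥ 1`; with André's factor the transpose of `L ↦ (0 0 ; 1 0)` is `ᶜΛ ↦ (0 1 ; 0 0)` exactly). [cite: Andre1996Motifs, Prop. 1.2 (p. 11) and §1.2 (p. 11)] -/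
theorem IsSymplectic.trace_mul_mul_andreStar (hω : IsSymplectic ω g) (hg : 0 < g) (x y : ExteriorAlgebra K W) :
    trace ω g (ω * x * andreStar ω g y) = trace ω g (x * andreStar ω g (lefschetzDual ω g y)) := by
  haveI := hω.finiteDimensional_exteriorAlgebra
  have h1 := hω.hasLefschetzProperty_mul.isAdjointPair_compl₂_andreHodgeInvolution
    (isZGrading_shiftedDegree K (fun i : ℕ ↦ ⋀[K]^i W) g) g (B := (LinearMap.mul K (ExteriorAlgebra K W)).compr₂ (trace ω g))
    (isSelfAdjoint_mul_trace hω.mem ω g) x y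
  rw [← hω.andreStar_eq, hω.dual_eq_lefschetzDual hg] at h1
  simpa only [LinearMap.compl₂_apply, LinearMap.compr₂_apply, LinearMap.mul_apply'] using h1

/-- … and symmetrically `τ(Λ_ω x ∧ *_H y) = τ(x ∧ *_H (ω ∧ y))` (`g ≥ 1`). [cite: Andre1996Motifs, Prop. 1.2 (p. 11)] -/
theorem IsSymplectic.trace_lefschetzDual_mul_andreStar (hω : IsSymplectic ω g) (hg : 0 < g) (x y : ExteriorAlgebra K W) :
    trace ω g (lefschetzDual ω g x * andreStar ω g y) = trace ω g (x * andreStar ω g (ω * y)) := by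
  haveI := hω.finiteDimensional_exteriorAlgebra
  have h1 := hω.hasLefschetzProperty_mul.isAdjointPair_compl₂_andreHodgeInvolution'
    (isZGrading_shiftedDegree K (fun i : ℕ ↦ ⋀[K]^i W) g) g (B := (LinearMap.mul K (ExteriorAlgebra K W)).compr₂ (trace ω g))
    (isSkewAdjoint_shiftedDegree_trace ω g) (isSelfAdjoint_mul_trace hω.mem ω g) x y
  rw [← hω.andreStar_eq, hω.dual_eq_lefschetzDual hg] at h1
  simpa only [LinearMap.compl₂_apply, LinearMap.compr₂_apply, LinearMap.mul_apply'] using h1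

/-- For the Weyl operator: `τ(ω ∧ x ∧ w y) = −τ(x ∧ w (Λ_ω y))` (`g ≥ 1`; `(0 1 ; −1 0)` conjugates `ᶜΛ` into `−L`).
[cite: Andre1996Motifs, §1.2 (p. 11)] -/
theorem IsSymplectic.trace_mul_mul_weylStar (hω : IsSymplectic ω g) (hg : 0 < g) (x y : ExteriorAlgebra K W) :
    trace ω g (ω * x * weylStar ω g y) = -trace ω g (x * weylStar ω g (lefschetzDual ω g y)) := by
  haveI := hω.finiteDimensional_exteriorAlgebra
  have h1 := hω.hasLefschetzProperty_mul.isAdjointPair_compl₂_weylOperator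
    (isZGrading_shiftedDegree K (fun i : ℕ ↦ ⋀[K]^i W) g) (B := (LinearMap.mul K (ExteriorAlgebra K W)).compr₂ (trace ω g))
    (isSelfAdjoint_mul_trace hω.mem ω g) x y
  rw [← hω.weylStar_eq, hω.dual_eq_lefschetzDual hg] at h1
  simpa only [LinearMap.compl₂_apply, LinearMap.compr₂_apply, LinearMap.mul_apply', LinearMap.neg_apply, map_neg, mul_neg]
    using h1

/-! ## §3 Graded symmetry of `(x, y) ↦ τ(x ∧ *y)` for `* = *_H, w` -/

omit [CharZero K] in
/-- The sign `(−1)^{(2g−a)a} = (−1)ᵃ`. [folklore] -/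
private theorem neg_one_pow_two_mul_sub_mul {a : ℕ} (hag : a ≤ 2 * g) : (-1 : K) ^ ((2 * g - a) * a) = (-1 : K) ^ a := by
  rcases Nat.even_or_odd a with ⟨r, hr⟩ | ⟨r, hr⟩
  · rw [hr, show (2 * g - (r + r)) * (r + r) = 2 * ((2 * g - (r + r)) * r) by ring, pow_mul, neg_one_sq, one_pow,
      show r + r = 2 * r by ring, pow_mul, neg_one_sq, one_pow]
  · have h1 : (2 * g - a) * a = 2 * (((2 * g - a) * a) / 2) + 1 := by
      have hodd : Odd ((2 * g - a) * a) := Nat.odd_mul.2 ⟨by rw [hr]; exact ⟨g - r - 1, by omega⟩, ⟨r, hr⟩⟩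
      obtain ⟨m, hm⟩ := hodd; omega
    rw [h1, pow_succ, pow_mul, neg_one_sq, one_pow, one_mul, hr, pow_succ, pow_mul, neg_one_sq, one_pow, one_mul]

/-- **Graded symmetry of `(x, y) ↦ τ(x ∧ *_H y)`**: `τ(x ∧ *_H y) = (−1)ᵃ τ(y ∧ *_H x)` for `x, y ∈ ⋀ᵃ W`.
[cite: Andre1996Motifs, §1.1 (p. 11) and Prop. 1.2 (p. 11)] [cite: BourbakiAlgebre1a3, Ch. III §7 no. 1] -/
theorem IsSymplectic.trace_mul_andreStar_swap (hω : IsSymplectic ω g) {a : ℕ} {x y : ExteriorAlgebra K W} (hx : x ∈ ⋀[K]^a W)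
    (hy : y ∈ ⋀[K]^a W) : trace ω g (x * andreStar ω g y) = ((-1 : K) ^ a) • trace ω g (y * andreStar ω g x) := by
  by_cases ha : a ≤ 2 * g
  · have hsx : andreStar ω g x ∈ ⋀[K]^(2 * g - a) W := hω.andreStar_apply_mem (by omega) hx
    rw [← hω.trace_andreStar_mul, mul_comm_of_mem hsx hy, map_smul, neg_one_pow_two_mul_sub_mul ha]
  · have hx0 : x = 0 := by
      have := hω.exteriorPower_eq_bot_of_lt a (by omega); rw [this] at hx; simpa using hx
    have hy0 : y = 0 := by
      have := hω.exteriorPower_eq_bot_of_lt a (by omega); rw [this] at hy; simpa using hy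
    rw [hx0, hy0, zero_mul, map_zero, smul_zero]

/-- **Graded symmetry of `(x, y) ↦ τ(x ∧ w y)`**: `τ(x ∧ w y) = (−1)ᵃ τ(y ∧ w x)` for `x, y ∈ ⋀ᵃ W`.
[cite: Andre1996Motifs, §1.2 (p. 11)] [cite: BourbakiAlgebre1a3, Ch. III §7 no. 1] -/
theorem IsSymplectic.trace_mul_weylStar_swap (hω : IsSymplectic ω g) {a : ℕ} {x y : ExteriorAlgebra K W} (hx : x ∈ ⋀[K]^a W)
    (hy : y ∈ ⋀[K]^a W) : trace ω g (x * weylStar ω g y) = ((-1 : K) ^ a) • trace ω g (y * weylStar ω g x) := by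
  by_cases ha : a ≤ 2 * g
  · have hsx : weylStar ω g x ∈ ⋀[K]^(2 * g - a) W := hω.weylStar_apply_mem (by omega) hx
    rw [← hω.trace_weylStar_mul, mul_comm_of_mem hsx hy, map_smul, neg_one_pow_two_mul_sub_mul ha]
  · have hx0 : x = 0 := by
      have := hω.exteriorPower_eq_bot_of_lt a (by omega); rw [this] at hx; simpa using hx
    have hy0 : y = 0 := by
      have := hω.exteriorPower_eq_bot_of_lt a (by omega); rw [this] at hy; simpa using hy
    rw [hx0, hy0, zero_mul, map_zero, smul_zero]

end Literature.AlgebraicGeometry.Motives.ExteriorLefschetz
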